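import Summits.Parity.BatemanHorn.Theses.SelbergDelangeRigidity

/-!
# Route SelbergDelangeRigidity — Assembly

The assembly item of route `SelbergDelangeRigidity` (sub-problem `BatemanHorn`, summit `Parity`):
`NormalFamilyBound → LSDRealSegment → VitaliExtraction → CoefficientExtraction → BatemanHorn`.

This is pure logic: fix `k`, `f`, `hf : IsBatemanHornSystem f`; `LSDRealSegment` gives `Λ`
(holomorphic on `|z| < 2`, `Λ 0 = C(f)`) and convergence on the real segment; `NormalFamilyBound`
gives `η` and the local bounds on `V_η`; `VitaliExtraction` turns these into convergence of the
`k`-th `z`-derivatives at `0`; `CoefficientExtraction` turns that into `BatemanHornAsymptotic f`.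
-/

namespace Summit.Parity.BatemanHorn.Theorems

/-- **Assembly of route `SelbergDelangeRigidity`.** The four route items
`NormalFamilyBound`, `LSDRealSegment`, `VitaliExtraction`, `CoefficientExtraction` together imply
the Bateman–Horn conjecture `_root_.BatemanHorn` (pure bookkeeping: instantiate the two cruxes at
`(k, f, hf)`, feed the resulting `Λ`, `η`, local bounds and real-segment convergence to
`VitaliExtraction`, and the resulting convergence of `k`-th derivatives at `0` to
`CoefficientExtraction`). -/
theorem selbergDelangeRigidityAssembly_proof :
    Summit.Parity.BatemanHorn.Theses.SelbergDelangeRigidity.Assembly := by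
  unfold Summit.Parity.BatemanHorn.Theses.SelbergDelangeRigidity.Assembly
  intro hN hL hV hE k f hf
  obtain ⟨Λ, hΛ, hΛ0, hU⟩ := hL k f hf
  obtain ⟨η, hη, hη4, hB⟩ := hN k f hf
  exact hE k f hf Λ hΛ hΛ0 (hV k f Λ η hη hη4 hΛ hB hU)

end Summit.Parity.BatemanHorn.Theorems
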